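import Literature.NumberTheory.EllipticCurves.FunctionFieldEllipticL
import Literature.NumberTheory.EllipticCurves.FunctionFieldPlacesProductFormulaProofs
import Literature.NumberTheory.EllipticCurves.FunctionFieldPlacesOrdProofs
import Literature.NumberTheory.EllipticCurves.FunctionFieldPlacesResidueCardProofs
import Literature.NumberTheory.EllipticCurves.HeightsProofs
import Literature.NumberTheory.DiophantineGeometry.CanonicalHeightProofs
import HarnessLib

/-!
# Heights on `E(F)` over a global function field: approximate parallelogram law (proofs)

Discharge of the named facts `Literature.NumberTheory.EllipticCurves.FunctionField.hasApproxParallelogramLaw_naiveHeight` and (as a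
corollary) `Literature.NumberTheory.EllipticCurves.FunctionField.isCanonicalHeightFor_canonicalHeight` of
`Literature.NumberTheory.EllipticCurves.FunctionFieldEllipticL`: for an elliptic curve `E` (a
Weierstrass curve `W` with `Δ ≠ 0`) over a global function field `F / 𝔽_q(T)`, the naive height
`h(P) = log q · deg (x(P))_∞ = log q · ∑_v max (0, -ord_v x(P)) · deg v` on `E(F)` satisfies
`h(P + Q) + h(P - Q) = 2 h(P) + 2 h(Q) + O(1)` (Silverman, *The Arithmetic of Elliptic Curves*,
Thm. VIII.6.2, whose proof is valid over every field with a product formula; Ulmer, *Elliptic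
curves over function fields*, Lecture 1, §11 (arXiv numbering), p. 14: "one can then introduce a
theory of heights exactly as in [Silverman, AEC]").

## Proof architecture

The parallelogram law itself is already proved in the tree over **any** field carrying an
admissible family of absolute values (Mathlib's `Height.AdmissibleAbsValues`): the theorem
`WeierstrassCurve.Affine.Point.abs_naiveHeight_add_add_naiveHeight_sub_sub_le` of
`Literature.NumberTheory.EllipticCurves.HeightsProofs` (Silverman VIII.6.2 for `f = x`, built on
Mathlib's `WeierstrassCurve.abs_logHeight_addSubMap_sub_two_mul_logHeight_le`) bounds
`|h(P + Q) + h(P - Q) - 2 h(P) - 2 h(Q)|` for the G06 naive height `h(P) = logHeight₁ (x(P))`.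
What this file supplies is the function-field input:

1. `Place.min_ord_le_ord_add`: the ultrametric inequality for `ord_v` (Stichtenoth Def. I.1.9 (3),
   Thm. I.1.13), from Mathlib's valuation of the height-one prime `m_v ⊂ O_v` and the comparison
   `valuation_eq_exp_neg_ord_holds`.
2. `Place.absValue q v`: the real absolute value `|x|_v = q ^ (-(deg v) · ord_v x)` of a place
   (Stichtenoth Remark I.1.10 / Bombieri–Gubler 1.4.6 with `c = q⁻¹`), non-archimedean.
3. `Place.finite_setOf_ord_ne_zero`: a nonzero element of a global function field has finitely
   many zeros and poles (Stichtenoth Cor. I.3.4), assembled from the separable chart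
   `Place.finite_zeros_and_finsum_eq_finrank` and the `p`-power descent
   `exists_pow_eq_and_isSeparable` of `FunctionFieldPlacesProductFormulaProofs` exactly as the
   product formula `finsum_ord_mul_degree_eq_zero_holds` is assembled there.
4. `admissibleAbsValues Fq F : Height.AdmissibleAbsValues F`: no archimedean absolute values, the
   non-archimedean ones are the `|·|_v` (pairwise distinct, `Place.absValue_injective`), finite
   support by (3) and the product formula `∏_v |x|_v = q ^ (-∑_v ord_v(x) deg v) = 1` by
   `finsum_ord_mul_degree_eq_zero_holds` (Bombieri–Gubler Prop. 1.4.7).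
5. `logHeight₁_eq_finsum` / `naiveHeight_eq_naiveHeight`: for this family,
   `logHeight₁ x = log q · ∑_v max (0, -ord_v x) deg v` (Bombieri–Gubler Example 1.5.23,
   `h(f) = -∑_Z deg Z · min (0, ord_Z f)`), i.e. the G06 naive height of `P ∈ E(F)` *is*
   `Literature.FunctionField.naiveHeight q W P`.
6. `hasApproxParallelogramLaw_naiveHeight_holds`: transport of the G06 theorem along (5).
7. `isCanonicalHeightFor_canonicalHeight_holds`: the corollary the fact was stated for — Tate's
   limit `canonicalHeight q W = canonicalHeightOf (naiveHeight q W)` is a canonical height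
   (`Literature.NumberTheory.DiophantineGeometry.isCanonicalHeightFor_canonicalHeightOf_holds` of `CanonicalHeightProofs`, fed with (6) and
   the evenness `naiveHeight_neg`); this is the interim proof preserved as a comment in
   `FunctionFieldEllipticL`.

## Design notes

* `admissibleAbsValues` is a `def`, not an instance: the constant field `Fq` cannot be inferred
  from `F`, and `F` carries no canonical admissible family in Mathlib (its TODO list in
  `Mathlib/NumberTheory/Height/Basic.lean` asks for one on function fields). It is installed with
  `letI` where needed; statements mentioning the G06 height are written with an explicit `@`.
* `Place.absValue q v` is defined for every `q : ℕ` and every place of every field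
  (`|x|_v = exp (-(ord_v x · deg_q v · log q))`); it is the trivial absolute value when
  `deg_q v = 0` or `q ≤ 1` (junk inputs), which is harmless.

## References

* J. H. Silverman, *The Arithmetic of Elliptic Curves*, 2nd ed., GTM 106 (2009), Thm. VIII.6.2,
  pp. 205–206. [SilvermanAEC2009]
* D. Ulmer, *Elliptic curves over function fields*, IAS/Park City Math. Ser. 18 (2011),
  Lecture 1, §11 (the Mordell–Weil–Lang–Néron theorem), p. 14 of arXiv:1101.1939.
  [Ulmer2011ParkCity]
* H. Stichtenoth, *Algebraic Function Fields and Codes*, 2nd ed., GTM 254 (2009), Def. I.1.9,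
  Remark I.1.10, Thm. I.1.13, Cor. I.3.4, Thm. I.4.11. [Stichtenoth2009]
* E. Bombieri, W. Gubler, *Heights in Diophantine Geometry* (2006), 1.4.6, Prop. 1.4.7,
  Example 1.5.23. [BombieriGubler2006]
-/

noncomputable section

open scoped Classical Polynomial

namespace Literature.NumberTheory.EllipticCurves.FunctionField

/-! ## The ultrametric inequality and the absolute value of a place -/

namespace Place

variable {F : Type} [Field F]

/-- The ultrametric inequality `ord_v (x + y) ≥ min (ord_v x, ord_v y)` for `x, y, x + y ≠ 0`
(the hypotheses avoid the junk value `ord_v 0 = 0`); property (3) of a discrete valuation,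
Stichtenoth Def. I.1.9 and Thm. I.1.13 (`v_P` is a discrete valuation). Proof: Mathlib's
`m_v`-adic valuation is `exp (-ord_v)` (`valuation_eq_exp_neg_ord_holds`) and is ultrametric.
[cite: Stichtenoth2009, Def. I.1.9 (3) and Thm. I.1.13] -/
theorem min_ord_le_ord_add (v : Place F) {x y : F} (hx : x ≠ 0) (hy : y ≠ 0) (hxy : x + y ≠ 0) :
    min (v.ord x) (v.ord y) ≤ v.ord (x + y) := by
  have h := Valuation.map_add (v.spectrum.valuation F) x y
  rw [valuation_eq_exp_neg_ord_holds v x hx, valuation_eq_exp_neg_ord_holds v y hy,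
    valuation_eq_exp_neg_ord_holds v (x + y) hxy, le_max_iff, WithZero.exp_le_exp,
    WithZero.exp_le_exp] at h
  rw [min_le_iff]
  omega

/-- The real absolute value of the place `v` in base `q`:
`|x|_v = q ^ (-(deg_q v) · ord_v x)` for `x ≠ 0` (written as `exp (-(ord_v x · deg_q v · log q))`)
and `|0|_v = 0`. This is the absolute value `c ^ {v(x)}` of Stichtenoth Remark I.1.10 with
`c = q ^ (-deg v)`, i.e. the normalisation `|f|_Z = c ^ {ord_Z(f) deg Z}`, `c = q⁻¹`, of
Bombieri–Gubler 1.4.6, for which the product formula holds over a global function field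
(`finprod_absValue_eq_one`). For junk inputs (`q ≤ 1` or `deg_q v = 0`) it is the trivial absolute
value. Mathlib anchor: for `q = #𝔽_q` and `F` a global function field over `𝔽_q` it agrees
pointwise with Mathlib's `IsDedekindDomain.HeightOneSpectrum.adicAbv` of `v.spectrum` in base
`b = residueCard v = q ^ deg v` (`|x| = b ^ (-ord_v x)`, via `valuation_eq_exp_neg_ord` and
`residueCard_eq_pow_degree`); the comparison lemma is not stated here.
[cite: Stichtenoth2009, Remark I.1.10; BombieriGubler2006, 1.4.6] -/
def absValue (q : ℕ) (v : Place F) : AbsoluteValue F ℝ where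
  toFun x := if x = 0 then 0 else Real.exp (-((v.ord x : ℝ) * (v.degree q : ℝ) * Real.log q))
  map_mul' x y := by
    by_cases hx : x = 0
    · simp [hx]
    by_cases hy : y = 0
    · simp [hy]
    simp only [mul_ne_zero hx hy, hx, hy, if_false, ← Real.exp_add, v.ord_mul hx hy]
    push_cast
    ring_nf
  nonneg' x := by
    split_ifs
    · exact le_rfl
    · exact (Real.exp_pos _).le
  eq_zero' x := by
    split_ifs with h
    · simp [h]
    · simp [h, (Real.exp_pos _).ne']
  add_le' x y := by
    -- ultrametric, hence triangle
    have key : ∀ {a b : F}, a ≠ 0 → b ≠ 0 → a + b ≠ 0 → v.ord a ≤ v.ord b →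
        Real.exp (-((v.ord (a + b) : ℝ) * (v.degree q : ℝ) * Real.log q)) ≤
          Real.exp (-((v.ord a : ℝ) * (v.degree q : ℝ) * Real.log q)) := by
      intro a b ha hb hab hle
      have hmin := v.min_ord_le_ord_add ha hb hab
      rw [min_eq_left hle] at hmin
      have hL : 0 ≤ (v.degree q : ℝ) * Real.log q :=
        mul_nonneg (Nat.cast_nonneg _) (Real.log_natCast_nonneg q)
      have : (v.ord a : ℝ) * ((v.degree q : ℝ) * Real.log q) ≤
          (v.ord (a + b) : ℝ) * ((v.degree q : ℝ) * Real.log q) :=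
        mul_le_mul_of_nonneg_right (by exact_mod_cast hmin) hL
      rw [Real.exp_le_exp]
      nlinarith
    by_cases hx : x = 0
    · simp [hx]
    by_cases hy : y = 0
    · simp [hy]
    by_cases hxy : x + y = 0
    · simp only [hxy, if_true, hx, hy, if_false]
      positivity
    simp only [hxy, hx, hy, if_false]
    rcases le_total (v.ord x) (v.ord y) with hle | hle
    · exact (key hx hy hxy hle).trans (le_add_of_nonneg_right (Real.exp_pos _).le)
    · have hyx : y + x ≠ 0 := by rwa [add_comm]
      have := key hy hx hyx hle
      rw [add_comm y x] at this
      exact this.trans (le_add_of_nonneg_left (Real.exp_pos _).le)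

/-- Unfolding `absValue` off zero. [cite: Stichtenoth2009, Remark I.1.10] -/
theorem absValue_apply {q : ℕ} (v : Place F) {x : F} (hx : x ≠ 0) :
    v.absValue q x = Real.exp (-((v.ord x : ℝ) * (v.degree q : ℝ) * Real.log q)) := by
  simp [absValue, hx]

/-- `|x|_v` is non-archimedean: `|x + y|_v ≤ max (|x|_v, |y|_v)` (Stichtenoth Def. I.1.9 (3) via
Remark I.1.10). [cite: Stichtenoth2009, Def. I.1.9 (3) and Remark I.1.10] -/
theorem isNonarchimedean_absValue (q : ℕ) (v : Place F) : IsNonarchimedean (v.absValue q) := by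
  intro x y
  by_cases hx : x = 0
  · simp [hx]
  by_cases hy : y = 0
  · simp [hy]
  by_cases hxy : x + y = 0
  · rw [hxy, map_zero]
    exact le_max_of_le_left ((v.absValue q).nonneg x)
  have hL : 0 ≤ (v.degree q : ℝ) * Real.log q :=
    mul_nonneg (Nat.cast_nonneg _) (Real.log_natCast_nonneg q)
  rw [v.absValue_apply hx, v.absValue_apply hy, v.absValue_apply hxy, le_max_iff,
    Real.exp_le_exp, Real.exp_le_exp]
  have hmin := v.min_ord_le_ord_add hx hy hxy
  rcases le_total (v.ord x) (v.ord y) with hle | hle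
  · left
    rw [min_eq_left hle] at hmin
    have : (v.ord x : ℝ) * ((v.degree q : ℝ) * Real.log q) ≤
        (v.ord (x + y) : ℝ) * ((v.degree q : ℝ) * Real.log q) :=
      mul_le_mul_of_nonneg_right (by exact_mod_cast hmin) hL
    nlinarith
  · right
    rw [min_eq_right hle] at hmin
    have : (v.ord y : ℝ) * ((v.degree q : ℝ) * Real.log q) ≤
        (v.ord (x + y) : ℝ) * ((v.degree q : ℝ) * Real.log q) :=
      mul_le_mul_of_nonneg_right (by exact_mod_cast hmin) hL
    nlinarith

/-- `|x|_v = 1` unless `v` is a zero or a pole of `x` (`x ≠ 0`). [cite: Stichtenoth2009,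
Remark I.1.10] -/
theorem absValue_eq_one_of_ord_eq_zero {q : ℕ} (v : Place F) {x : F} (hx : x ≠ 0)
    (h : v.ord x = 0) : v.absValue q x = 1 := by
  rw [v.absValue_apply hx, h]
  simp

/-- `log⁺ |x|_v = log q · max (0, -ord_v x) · deg v`: the local contribution of `v` to the
logarithmic height of `x` is its pole order at `v` weighted by `deg v` (Bombieri–Gubler
Example 1.5.23, `h(f) = -∑_Z deg Z · min (0, ord_Z f)`; here in units of `log q`).
[cite: BombieriGubler2006, Example 1.5.23] -/
theorem posLog_absValue (q : ℕ) (v : Place F) (x : F) :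
    Real.posLog (v.absValue q x) =
      Real.log q * ((((max 0 (-(v.ord x))) * (v.degree q : ℤ) : ℤ)) : ℝ) := by
  rcases eq_or_ne x 0 with rfl | hx
  · simp [Real.posLog]
  have hL : 0 ≤ (v.degree q : ℝ) * Real.log q :=
    mul_nonneg (Nat.cast_nonneg _) (Real.log_natCast_nonneg q)
  rw [v.absValue_apply hx, Real.posLog, Real.log_exp]
  push_cast
  have : -((v.ord x : ℝ) * (v.degree q : ℝ) * Real.log q) =
      (-(v.ord x : ℝ)) * ((v.degree q : ℝ) * Real.log q) := by ring
  rw [this, ← zero_mul ((v.degree q : ℝ) * Real.log q), ← max_mul_of_nonneg _ _ hL, zero_mul]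
  ring

end Place

/-! ## Finitely many zeros and poles -/

section Finiteness

open IntermediateField

variable {Fq : Type} [Field Fq] [Fintype Fq] {F : Type} [Field F] [Algebra Fq F]

namespace Place

/-- Separable chart of Stichtenoth Cor. I.3.4: for `y` transcendental over `𝔽_q` with `F / 𝔽_q(y)`
finite separable, `y` has finitely many zeros and poles (the zeros of `y` and of `y⁻¹` each count
at most `[F : 𝔽_q(y)]`, `Place.finite_zeros_and_finsum_eq_finrank`). [cite: Stichtenoth2009,
Cor. I.3.4] -/
theorem finite_setOf_ord_ne_zero_of_isSeparable (y : F) (hy : Transcendental Fq y)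
    [FiniteDimensional Fq⟮y⟯ F] [Algebra.IsSeparable Fq⟮y⟯ F] :
    {v : Place F | v.ord y ≠ 0}.Finite := by
  have hyi : Transcendental Fq y⁻¹ := fun h => hy (by simpa using h.inv)
  have heq : Fq⟮y⁻¹⟯ = Fq⟮y⟯ := adjoin_simple_inv_eq y
  haveI : FiniteDimensional Fq⟮y⁻¹⟯ F := by rw [heq]; infer_instance
  haveI : Algebra.IsSeparable Fq⟮y⁻¹⟯ F := by rw [heq]; infer_instance
  have hZ := (finite_zeros_and_finsum_eq_finrank (Fq := Fq) y hy).1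
  have hP := (finite_zeros_and_finsum_eq_finrank (Fq := Fq) y⁻¹ hyi).1
  refine (hZ.union hP).subset ?_
  intro v hv
  simp only [Set.mem_setOf_eq, Set.mem_union, ord_inv] at hv ⊢
  omega

/-- Stichtenoth Cor. I.3.4 for `F / 𝔽_q` finitely generated of transcendence degree `1`: a nonzero
`x` has finitely many zeros and poles. A transcendental `x` is `y ^ (p ^ e)` with `F / 𝔽_q(y)`
separable (`exists_pow_eq_and_isSeparable`) and `ord_v x = p ^ e · ord_v y`; a nonzero algebraic
`x` is a root of unity and has `ord_v x = 0` everywhere. [cite: Stichtenoth2009, Cor. I.3.4] -/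
theorem finite_setOf_ord_ne_zero_aux (p : ℕ) [Fact p.Prime] [CharP F p]
    [Algebra.EssFiniteType Fq F] (h1 : Algebra.trdeg Fq F = 1) {x : F} (hx0 : x ≠ 0) :
    {v : Place F | v.ord x ≠ 0}.Finite := by
  by_cases hx : Transcendental Fq x
  · obtain ⟨y, e, rfl, hyt, hsep⟩ := exists_pow_eq_and_isSeparable Fq p h1 hx
    haveI := finiteDimensional_adjoin_simple_of_transcendental Fq h1 hyt
    refine (finite_setOf_ord_ne_zero_of_isSeparable y hyt).subset ?_
    intro v hv
    simp only [Set.mem_setOf_eq, ord_pow] at hv ⊢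
    exact fun h => hv (by rw [h, mul_zero])
  · have halg : IsAlgebraic Fq x := by
      unfold Transcendental at hx
      exact not_not.1 hx
    haveI : FiniteDimensional Fq Fq⟮x⟯ := adjoin.finiteDimensional halg.isIntegral
    haveI : Finite Fq⟮x⟯ := Module.finite_of_finite Fq
    letI : Fintype Fq⟮x⟯ := Fintype.ofFinite _
    set x' : Fq⟮x⟯ := ⟨x, mem_adjoin_simple_self Fq x⟩ with hx'_def
    have hx' : x' ≠ 0 := fun h => hx0 (congrArg Subtype.val h)
    have hpow : x ^ (Fintype.card Fq⟮x⟯ - 1) = 1 := by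
      have h := congrArg Subtype.val (FiniteField.pow_card_sub_one_eq_one x' hx')
      simpa using h
    have hn : 0 < Fintype.card Fq⟮x⟯ - 1 := by
      have := Fintype.one_lt_card (α := Fq⟮x⟯)
      omega
    have hempty : {v : Place F | v.ord x ≠ 0} = ∅ := by
      ext v
      simp [v.ord_eq_zero_of_pow_eq_one hn hpow]
    rw [hempty]
    exact Set.finite_empty

end Place

end Finiteness

/-! ## The admissible family of a global function field -/

section FunctionField

variable (Fq F : Type) [Field Fq] [Fintype Fq] [Field F] [Algebra Fq[X] F]
  [Algebra (RatFunc Fq) F] [IsScalarTower Fq[X] (RatFunc Fq) F] [FunctionField Fq F]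

namespace Place

include Fq in
/-- **Stichtenoth Cor. I.3.4** for a global function field `F / 𝔽_q(T)`: every `x ≠ 0` has only
finitely many zeros and poles, `{v | ord_v x ≠ 0}` is finite. The constant field acts through
`𝔽_q[T] → F` (installed locally, as in `finsum_ord_mul_degree_eq_zero_holds`).
[cite: Stichtenoth2009, Cor. I.3.4] -/
theorem finite_setOf_ord_ne_zero {x : F} (hx : x ≠ 0) :
    {v : Place F | v.ord x ≠ 0}.Finite := by
  letI : Algebra Fq F := ((algebraMap Fq[X] F).comp Polynomial.C).toAlgebra
  haveI : IsScalarTower Fq (RatFunc Fq) F := IsScalarTower.of_algebraMap_eq fun c => by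
    rw [IsScalarTower.algebraMap_apply Fq Fq[X] (RatFunc Fq) c, Polynomial.algebraMap_eq,
      ← IsScalarTower.algebraMap_apply Fq[X] (RatFunc Fq) F (Polynomial.C c)]
    rfl
  haveI : Algebra.EssFiniteType Fq F := essFiniteType_of_ratFunc Fq F
  have h1 : Algebra.trdeg Fq F = 1 := trdeg_eq_one_of_ratFunc Fq F
  obtain ⟨p, hchar⟩ := CharP.exists Fq
  have hp : p.Prime := CharP.char_is_prime Fq p
  haveI : Fact p.Prime := ⟨hp⟩
  haveI : CharP F p := charP_of_injective_algebraMap (algebraMap Fq F).injective p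
  exact finite_setOf_ord_ne_zero_aux p h1 hx

omit [Algebra Fq[X] F] [IsScalarTower Fq[X] (RatFunc Fq) F] in
/-- Over a global function field, `|x|_v ≤ 1 ↔ 0 ≤ ord_v x` for `x ≠ 0` (as `deg v > 0` and
`q > 1`), so `O_v = {x | |x|_v ≤ 1}`. [cite: Stichtenoth2009, Remark I.1.10 and Thm. I.1.13] -/
theorem absValue_le_one_iff (v : Place F) {x : F} (hx : x ≠ 0) :
    v.absValue (Fintype.card Fq) x ≤ 1 ↔ 0 ≤ v.ord x := by
  have hq : (1 : ℝ) < (Fintype.card Fq : ℕ) := by exact_mod_cast Fintype.one_lt_card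
  have hd : (0 : ℝ) < (v.degree (Fintype.card Fq) : ℕ) := by
    exact_mod_cast degree_pos_of_finiteDimensional Fq v
  have hL : (0 : ℝ) < (v.degree (Fintype.card Fq) : ℝ) * Real.log (Fintype.card Fq) :=
    mul_pos hd (Real.log_pos hq)
  rw [v.absValue_apply hx, Real.exp_le_one_iff, neg_nonpos, mul_assoc]
  constructor
  · intro h
    by_contra hneg
    push Not at hneg
    have : (v.ord x : ℝ) < 0 := by exact_mod_cast hneg
    nlinarith
  · intro h
    exact mul_nonneg (by exact_mod_cast h) hL.le

omit [Algebra Fq[X] F] [IsScalarTower Fq[X] (RatFunc Fq) F] in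
/-- The absolute values of distinct places of a global function field are distinct (indeed
inequivalent, Bombieri–Gubler Prop. 1.4.7): `O_v = {x | |x|_v ≤ 1}` recovers the place.
[cite: BombieriGubler2006, Prop. 1.4.7] -/
theorem absValue_injective :
    Function.Injective (absValue (Fintype.card Fq) : Place F → AbsoluteValue F ℝ) := by
  intro v w h
  apply Subtype.ext
  ext y
  rcases eq_or_ne y 0 with rfl | hy
  · simp
  rw [← v.ord_nonneg_iff hy, ← w.ord_nonneg_iff hy, ← absValue_le_one_iff Fq F v hy,
    ← absValue_le_one_iff Fq F w hy, h]

/-- **Product formula** for the absolute values `|·|_v` of a global function field: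
`∏_v |x|_v = q ^ (-∑_v ord_v(x) deg v) = 1` for `x ≠ 0` (Bombieri–Gubler Prop. 1.4.7, from the
degree of a principal divisor being `0`, here `finsum_ord_mul_degree_eq_zero_holds` =
Stichtenoth Thm. I.4.11). [cite: BombieriGubler2006, Prop. 1.4.7; Stichtenoth2009, Thm. I.4.11] -/
theorem finprod_absValue_eq_one {x : F} (hx : x ≠ 0) :
    ∏ᶠ v : Place F, v.absValue (Fintype.card Fq) x = 1 := by
  set s := (finite_setOf_ord_ne_zero Fq F hx).toFinset with hs
  have hsupp : (Function.mulSupport fun v : Place F => v.absValue (Fintype.card Fq) x) ⊆ s := by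
    intro v hv
    rw [Function.mem_mulSupport] at hv
    simp only [hs, Set.Finite.coe_toFinset, Set.mem_setOf_eq]
    exact fun h0 => hv (v.absValue_eq_one_of_ord_eq_zero hx h0)
  rw [finprod_eq_prod_of_mulSupport_subset _ hsupp]
  simp only [absValue_apply _ hx]
  rw [← Real.exp_sum, Real.exp_eq_one_iff]
  have hsupp' : (Function.support fun v : Place F =>
      v.ord x * (v.degree (Fintype.card Fq) : ℤ)) ⊆ s := by
    intro v hv
    rw [Function.mem_support] at hv
    simp only [hs, Set.Finite.coe_toFinset, Set.mem_setOf_eq]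
    exact fun h0 => hv (by rw [h0, zero_mul])
  have hpf := finsum_ord_mul_degree_eq_zero_holds Fq F x hx
  rw [finsum_eq_sum_of_support_subset _ hsupp'] at hpf
  have hcast : ∑ v ∈ s, (v.ord x : ℝ) * (v.degree (Fintype.card Fq) : ℝ) = 0 := by
    have := congrArg (fun n : ℤ => (n : ℝ)) hpf
    push_cast at this
    exact this
  calc ∑ v ∈ s, -((v.ord x : ℝ) * (v.degree (Fintype.card Fq) : ℝ) * Real.log (Fintype.card Fq))
      = -(Real.log (Fintype.card Fq) *
          ∑ v ∈ s, (v.ord x : ℝ) * (v.degree (Fintype.card Fq) : ℝ)) := by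
        rw [Finset.mul_sum, ← Finset.sum_neg_distrib]
        exact Finset.sum_congr rfl fun v _ => by ring
    _ = 0 := by rw [hcast, mul_zero, neg_zero]

end Place

/-- **The admissible family of absolute values of a global function field** `F / 𝔽_q(T)`
(Bombieri–Gubler 1.4.6–1.4.9, the set `M_X` for the curve `X` with function field `F`, with
`c = q⁻¹`): no archimedean absolute values; the non-archimedean ones are the `|·|_v`,
`|x|_v = q ^ (-(deg v) ord_v x)`, indexed by all places `v` of `F` (pairwise distinct,
`Place.absValue_injective`); for `x ≠ 0` only finitely many `|x|_v ≠ 1` (Stichtenoth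
Cor. I.3.4) and `∏_v |x|_v = 1` (Bombieri–Gubler Prop. 1.4.7). A `def` and not an instance: `Fq`
is not determined by `F`. Relation to Mathlib's TODO in `Mathlib/NumberTheory/Height/Basic.lean`,
which reads "Add `Height.AdmissibleAbsValues` instances for fields of rational functions in `n`
variables and finite extensions of fields with `Height.AdmissibleAbsValues`": this covers the
one-variable case over a finite constant field (finite extensions of `𝔽_q(T)`), as a `def` rather
than an instance. [cite: BombieriGubler2006, 1.4.6 and Prop. 1.4.7] -/
@[reducible]
def admissibleAbsValues : Height.AdmissibleAbsValues F where
  archAbsVal := 0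
  nonarchAbsVal := Set.range (Place.absValue (Fintype.card Fq) : Place F → AbsoluteValue F ℝ)
  isNonarchimedean := by
    rintro _ ⟨v, rfl⟩
    exact Place.isNonarchimedean_absValue _ v
  hasFiniteMulSupport := by
    intro x hx
    refine ((Place.finite_setOf_ord_ne_zero Fq F hx).image fun v : Place F =>
      (⟨Place.absValue (Fintype.card Fq) v, v, rfl⟩ :
        Set.range (Place.absValue (Fintype.card Fq) : Place F → AbsoluteValue F ℝ))).subset ?_
    rintro ⟨_, v, rfl⟩ ha
    rw [Function.mem_mulSupport] at ha
    refine ⟨v, ?_, rfl⟩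
    simp only [Set.mem_setOf_eq]
    exact fun h0 => ha (v.absValue_eq_one_of_ord_eq_zero hx h0)
  product_formula := by
    intro x hx
    rw [Multiset.map_zero, Multiset.prod_zero, one_mul,
      finprod_set_coe_eq_finprod_mem (f := fun a : AbsoluteValue F ℝ => a x)
        (Set.range (Place.absValue (Fintype.card Fq) : Place F → AbsoluteValue F ℝ)),
      finprod_mem_range (Place.absValue_injective Fq F)]
    exact Place.finprod_absValue_eq_one Fq F hx

/-- For the admissible family of a global function field, the logarithmic height of `x ∈ F` is
`h(x) = ∑_v log⁺ |x|_v = log q · ∑_v max (0, -ord_v x) · deg v = log q · deg (x)_∞`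
(Bombieri–Gubler Example 1.5.23: `h(f) = -∑_Z deg Z min (0, ord_Z f)`, in units of `log q`).
[cite: BombieriGubler2006, Example 1.5.23] -/
theorem logHeight₁_eq_finsum (x : F) :
    @Height.logHeight₁ F _ (admissibleAbsValues Fq F) x =
      Real.log (Fintype.card Fq) *
        ∑ᶠ v : Place F, (((max 0 (-(v.ord x))) * (v.degree (Fintype.card Fq) : ℤ) : ℤ) : ℝ) := by
  letI := admissibleAbsValues Fq F
  rw [Height.logHeight₁_eq]
  change (Multiset.map (fun v : AbsoluteValue F ℝ => Real.posLog (v x)) 0).sum +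
      ∑ᶠ v : ↥(Set.range (Place.absValue (Fintype.card Fq) : Place F → AbsoluteValue F ℝ)),
        Real.posLog ((v : AbsoluteValue F ℝ) x) = _
  rw [Multiset.map_zero, Multiset.sum_zero, zero_add,
    finsum_set_coe_eq_finsum_mem (f := fun a : AbsoluteValue F ℝ => Real.posLog (a x))
      (Set.range (Place.absValue (Fintype.card Fq) : Place F → AbsoluteValue F ℝ)),
    finsum_mem_range (Place.absValue_injective Fq F), mul_finsum]
  exact finsum_congr fun v => Place.posLog_absValue _ v x

variable {F}
variable (W : WeierstrassCurve F)

/-- The G06 naive height `h(P) = logHeight₁ (x(P))` of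
`Literature.NumberTheory.EllipticCurves.Heights`, taken for the admissible family of the global
function field `F`, **is** the function-field naive height
`Literature.FunctionField.naiveHeight q W P = log q · deg (x(P))_∞` of `FunctionFieldEllipticL`
(Silverman AEC VIII.6, `h_x`; Bombieri–Gubler Example 1.5.23). [cite: BombieriGubler2006,
Example 1.5.23] -/
theorem naiveHeight_eq_naiveHeight (P : W.toAffine.Point) :
    @WeierstrassCurve.Affine.Point.naiveHeight F _ (admissibleAbsValues Fq F) W P =
      naiveHeight (Fintype.card Fq) W P := by
  rcases P with _ | ⟨x, y, h⟩
  · rfl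
  · exact logHeight₁_eq_finsum Fq F x

/-- **Discharge** of `hasApproxParallelogramLaw_naiveHeight` (**Silverman, AEC Thm. VIII.6.2**
over the global function field `F / 𝔽_q(T)`; Ulmer, Lecture 1 §11, p. 14: heights "exactly as in
[Silverman]"): the naive height `h(P) = log q · deg (x(P))_∞` of an elliptic curve over `F`
satisfies `|h(P + Q) + h(P - Q) - 2 h(P) - 2 h(Q)| ≤ C`. Proof: `F` carries the admissible family
`admissibleAbsValues Fq F` (product formula, Bombieri–Gubler Prop. 1.4.7), for which the G06
naive height is this `h` (`naiveHeight_eq_naiveHeight`), and the approximate parallelogram law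
holds for the G06 naive height over any admissibly valued field
(`WeierstrassCurve.Affine.Point.abs_naiveHeight_add_add_naiveHeight_sub_sub_le`, Silverman's
proof of VIII.6.2 with the degree-`2` morphism `g : ℙ² → ℙ²`).
[cite: SilvermanAEC2009, Thm. VIII.6.2; Ulmer2011ParkCity, Lecture 1 §11] -/
theorem hasApproxParallelogramLaw_naiveHeight_holds :
    hasApproxParallelogramLaw_naiveHeight Fq W := by
  intro _
  letI := admissibleAbsValues Fq F
  obtain ⟨C, hC⟩ :=
    WeierstrassCurve.Affine.Point.abs_naiveHeight_add_add_naiveHeight_sub_sub_le (W := W)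
  refine ⟨C, fun P Q => ?_⟩
  have h := hC P Q
  simp only [naiveHeight_eq_naiveHeight Fq W] at h
  exact h

/-- **Discharge** of `isCanonicalHeightFor_canonicalHeight` (**Tate**; Silverman, AEC
Thm. VIII.9.3 with Prop. VIII.9.1, over the global function field `F / 𝔽_q(T)`): the canonical
height `ĥ = lim h(2ⁿP)/4ⁿ` of `E / F` is a canonical height for the naive height `h` (exact
parallelogram law and `ĥ - h = O(1)`). This is the interim proof recorded in
`FunctionFieldEllipticL`: Tate's existence theorem `Literature.NumberTheory.DiophantineGeometry.isCanonicalHeightFor_canonicalHeightOf`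
(discharged in `CanonicalHeightProofs`) applied to `hasApproxParallelogramLaw_naiveHeight_holds`
and the evenness `h(-P) = h(P)` (`naiveHeight_neg`).
[cite: SilvermanAEC2009, Prop. VIII.9.1 and Thm. VIII.9.3] -/
theorem isCanonicalHeightFor_canonicalHeight_holds :
    isCanonicalHeightFor_canonicalHeight Fq W := by
  intro _
  exact Literature.NumberTheory.DiophantineGeometry.isCanonicalHeightFor_canonicalHeightOf_holds
    (hasApproxParallelogramLaw_naiveHeight_holds Fq W) ⟨0, fun P => by simp⟩

end FunctionField

end Literature.NumberTheory.EllipticCurves.FunctionField
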